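import Summits.Ventures.Crystal3D.Theorems.StickyWulffConstantNoReconstructionGainSublevelPlug
import Summits.Ventures.Crystal3D.Theorems.StickyWulffConstantGenericWallFloorAffineSampleDeficit
import HarnessLib

/-!
# Placement-free rungs of the atom, II: moved lattices `A·Λ₀ + t`

HONEST FRAMING. Part of the venture `Summits/Ventures/Crystal3D` (cell `crystal3d-full`), helper
`--supports` the crux `NoReconstructionGain` (stmt-Ventures-19144, route
`route-Ventures-StickyWulffConstant`), line `adhesion`; companion of `…NoReconstructionGainSublevelPlug`.
The gauge-form rungs there (plug = any set of sites of `Λ₀` separated from the registry film balls by a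
midpoint-convex gauge) are transported to a plug cut from a MOVED lattice `A·Λ₀ + t` (`A` a linear
isometry, `t` a translation) by pulling the whole configuration back through the rigid motion: contacts,
cross-contacts and `contactDeficiency` are isometry invariants (`card_cross_image_of_isometry`,
`contactDeficiency_image_of_isometry`), midpoint-convexity and coplanarity are affine invariants.  Results
(`C = 0`, no normal, no radius, uniform in `A, t`):

* `movedGaugePlug_threeDegenerate_adhesion` — off-moved-lattice part contact-3-degenerate;
* `movedGaugePlug_coplanarOffLattice_adhesion` — off-moved-lattice part coplanar.

This is the fcc (`σ ≡ +1`) slice of the T line's `stub_barlowAdhesion` (cf-p1 g16, `TexShadow.lean`: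
substrate `stacking L s σ`, origin-anchored window) for these film classes: the window
`{−2R ≤ ⟪p, ν⟫ ≤ −R, ‖p‖² − ⟪p, ν⟫² ≤ ρ²}` is the sublevel set of the midpoint-convex `slabGauge`.

WHAT THIS IS NOT: other Hägg words `σ` (hcp, polytypes) as substrates; the atom; rung F-C1 not moved.
-/

noncomputable section

namespace Summit.Ventures.Crystal3D.Theorems

open Summit.Ventures.Crystal3D Finset
open Literature.MathematicalPhysics.StatisticalMechanics (fccStacking orderedContacts contactDeficiency)
open scoped InnerProductSpace

/-- The number of cross-contact pairs is invariant under an isometry of `ℝ³`. -/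
theorem card_cross_image_of_isometry {g : EuclideanSpace ℝ (Fin 3) → EuclideanSpace ℝ (Fin 3)}
    (hg : Isometry g) (P Q : Finset (EuclideanSpace ℝ (Fin 3))) :
    (((P.image g) ×ˢ (Q.image g)).filter fun pq => dist pq.1 pq.2 = 1).card =
      ((P ×ˢ Q).filter fun pq => dist pq.1 pq.2 = 1).card := by
  classical
  rw [← prodMap_image_product, filter_image]
  have hinj : Function.Injective (Prod.map g g) := by
    intro p q h
    simp only [Prod.map, Prod.mk.injEq] at h
    exact Prod.ext (hg.injective h.1) (hg.injective h.2)
  rw [card_image_of_injective _ hinj]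
  congr 1
  refine filter_congr fun p _ => ?_
  simp only [Prod.map]
  rw [hg.dist_eq]

/-- The pull-back `p ↦ A⁻¹ (p − t)` of the rigid motion `z ↦ A z + t` is an isometry. -/
theorem isometry_pullback (A : EuclideanSpace ℝ (Fin 3) ≃ₗᵢ[ℝ] EuclideanSpace ℝ (Fin 3))
    (t : EuclideanSpace ℝ (Fin 3)) : Isometry fun p : EuclideanSpace ℝ (Fin 3) => A.symm (p - t) := by
  intro p q
  simp only [edist_dist]
  rw [A.symm.dist_map, dist_sub_right]

/-- **The atom for a plug cut from a MOVED fcc lattice by a gauge, off-lattice part contact-3-degenerate**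
(`C = 0`).  `X ⊇ P` a finite unit packing, `P ⊆ A·Λ₀ + t`, `f` midpoint-convex with `f p < f q` for
`p ∈ P` and every film ball `q` ON the moved lattice; if every nonempty set of film balls OFF the moved
lattice has a ball with `≤ 3` partners in it, then `#cross(P, X \ P) ≤ contactDeficiency (X \ P)`. -/
theorem movedGaugePlug_threeDegenerate_adhesion
    (A : EuclideanSpace ℝ (Fin 3) ≃ₗᵢ[ℝ] EuclideanSpace ℝ (Fin 3)) (t : EuclideanSpace ℝ (Fin 3))
    (X P : Finset (EuclideanSpace ℝ (Fin 3)))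
    (hX : ∀ p ∈ X, ∀ q ∈ X, p ≠ q → 1 ≤ dist p q) (hPX : P ⊆ X)
    (hPΛ : ∀ p ∈ P, A.symm (p - t) ∈ fccStacking 1 (Real.sqrt (2 / 3)))
    (f : EuclideanSpace ℝ (Fin 3) → ℝ)
    (hsep : ∀ p ∈ P, ∀ q ∈ X \ P, A.symm (q - t) ∈ fccStacking 1 (Real.sqrt (2 / 3)) → f p < f q)
    (hconv : ∀ q w : EuclideanSpace ℝ (Fin 3), 2 * f q ≤ f (q + w) + f (q - w))
    (hdeg : ∀ S ⊆ X \ P, (∀ x ∈ S, A.symm (x - t) ∉ fccStacking 1 (Real.sqrt (2 / 3))) → S.Nonempty →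
      ∃ q ∈ S, (S.filter fun x => dist q x = 1).card ≤ 3) :
    ((((P ×ˢ (X \ P)).filter fun pq => dist pq.1 pq.2 = 1).card : ℕ) : ℝ) ≤
      contactDeficiency (X \ P) := by
  classical
  set m : EuclideanSpace ℝ (Fin 3) → EuclideanSpace ℝ (Fin 3) := fun p => A.symm (p - t) with hm
  have hmi : Isometry m := isometry_pullback A t
  have hminj : Function.Injective m := hmi.injective
  have hback : ∀ p, A (m p) + t = p := fun p => by simp [hm]
  set X' := X.image m with hX'
  set P' := P.image m with hP'
  have hsd : X' \ P' = (X \ P).image m := by rw [hX', hP', image_sdiff_of_injOn hminj.injOn hPX]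
  -- hypotheses of the gauge form, pulled back
  have hXp : ∀ p ∈ X', ∀ q ∈ X', p ≠ q → 1 ≤ dist p q := by
    intro p hp q hq hpq
    obtain ⟨p₀, hp₀, rfl⟩ := mem_image.1 hp
    obtain ⟨q₀, hq₀, rfl⟩ := mem_image.1 hq
    rw [hmi.dist_eq]
    exact hX p₀ hp₀ q₀ hq₀ fun e => hpq (by rw [e])
  have hPXp : P' ⊆ X' := image_subset_image hPX
  have hPΛp : ∀ p ∈ P', p ∈ fccStacking 1 (Real.sqrt (2 / 3)) := by
    intro p hp
    obtain ⟨p₀, hp₀, rfl⟩ := mem_image.1 hp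
    exact hPΛ p₀ hp₀
  set f' : EuclideanSpace ℝ (Fin 3) → ℝ := fun y => f (A y + t) with hf'
  have hsep' : ∀ p ∈ P', ∀ q ∈ X' \ P', q ∈ fccStacking 1 (Real.sqrt (2 / 3)) → f' p < f' q := by
    intro p hp q hq hqΛ
    obtain ⟨p₀, hp₀, rfl⟩ := mem_image.1 hp
    rw [hsd] at hq
    obtain ⟨q₀, hq₀, rfl⟩ := mem_image.1 hq
    simp only [hf', hback]
    exact hsep p₀ hp₀ q₀ hq₀ hqΛ
  have hconv' : ∀ q w : EuclideanSpace ℝ (Fin 3), 2 * f' q ≤ f' (q + w) + f' (q - w) := by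
    intro q w
    simp only [hf', map_add, map_sub]
    have := hconv (A q + t) (A w)
    have e1 : A q + t + A w = A q + A w + t := by abel
    have e2 : A q + t - A w = A q - A w + t := by abel
    rw [e1, e2] at this
    exact this
  have hdeg' : ∀ S ⊆ X' \ P', (∀ x ∈ S, x ∉ fccStacking 1 (Real.sqrt (2 / 3))) → S.Nonempty →
      ∃ q ∈ S, (S.filter fun x => dist q x = 1).card ≤ 3 := by
    intro S hS hoff hne
    -- push `S` forward
    set T := S.image fun y => A y + t with hT
    have hTsub : T ⊆ X \ P := by
      intro x hx
      obtain ⟨y, hy, rfl⟩ := mem_image.1 hx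
      have hy' := hS hy
      rw [hsd] at hy'
      obtain ⟨x₀, hx₀, rfl⟩ := mem_image.1 hy'
      rw [hback]; exact hx₀
    have hToff : ∀ x ∈ T, A.symm (x - t) ∉ fccStacking 1 (Real.sqrt (2 / 3)) := by
      intro x hx
      obtain ⟨y, hy, rfl⟩ := mem_image.1 hx
      have : A.symm (A y + t - t) = y := by simp
      rw [this]; exact hoff y hy
    obtain ⟨y₀, hy₀⟩ := hne
    obtain ⟨q, hqT, hq⟩ := hdeg T hTsub hToff ⟨A y₀ + t, mem_image.2 ⟨y₀, hy₀, rfl⟩⟩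
    obtain ⟨y, hy, rfl⟩ := mem_image.1 hqT
    refine ⟨y, hy, ?_⟩
    have hfwd : Isometry fun z : EuclideanSpace ℝ (Fin 3) => A z + t := by
      intro a b; simp only [edist_dist]; rw [dist_add_right, A.dist_map]
    have : (S.filter fun x => dist y x = 1).card = (T.filter fun x => dist (A y + t) x = 1).card := by
      rw [hT, filter_image, card_image_of_injective _ hfwd.injective]
      congr 1
      refine filter_congr fun x _ => ?_
      show dist y x = 1 ↔ dist (A y + t) (A x + t) = 1
      rw [hfwd.dist_eq]
    rw [this]; exact hq
  have h := gaugePlug_threeDegenerate_adhesion X' P' hXp hPXp hPΛp f' hsep' hconv' hdeg'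
  -- transport the conclusion back
  rw [hsd, hP', card_cross_image_of_isometry hmi, contactDeficiency_image_of_isometry hmi] at h
  exact h

/-- **The atom for a plug cut from a moved fcc lattice by a gauge, off-lattice part COPLANAR** (`C = 0`). -/
theorem movedGaugePlug_coplanarOffLattice_adhesion
    (A : EuclideanSpace ℝ (Fin 3) ≃ₗᵢ[ℝ] EuclideanSpace ℝ (Fin 3)) (t : EuclideanSpace ℝ (Fin 3))
    (X P : Finset (EuclideanSpace ℝ (Fin 3)))
    (hX : ∀ p ∈ X, ∀ q ∈ X, p ≠ q → 1 ≤ dist p q) (hPX : P ⊆ X)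
    (hPΛ : ∀ p ∈ P, A.symm (p - t) ∈ fccStacking 1 (Real.sqrt (2 / 3)))
    (f : EuclideanSpace ℝ (Fin 3) → ℝ)
    (hsep : ∀ p ∈ P, ∀ q ∈ X \ P, A.symm (q - t) ∈ fccStacking 1 (Real.sqrt (2 / 3)) → f p < f q)
    (hconv : ∀ q w : EuclideanSpace ℝ (Fin 3), 2 * f q ≤ f (q + w) + f (q - w))
    (c n : EuclideanSpace ℝ (Fin 3)) (hn : n ≠ 0)
    (hplane : ∀ x ∈ X \ P, A.symm (x - t) ∉ fccStacking 1 (Real.sqrt (2 / 3)) → ⟪x - c, n⟫_ℝ = 0) :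
    ((((P ×ˢ (X \ P)).filter fun pq => dist pq.1 pq.2 = 1).card : ℕ) : ℝ) ≤
      contactDeficiency (X \ P) := by
  refine movedGaugePlug_threeDegenerate_adhesion A t X P hX hPX hPΛ f hsep hconv ?_
  intro S hS hoff hne
  refine exists_card_partners_le_three_of_coplanar S ?_ hne c n hn ?_
  · intro p hp q hq hpq
    exact hX p (sdiff_subset (hS hp)) q (sdiff_subset (hS hq)) hpq
  · intro p hp
    exact hplane p (hS hp) (hoff p hp)

end Summit.Ventures.Crystal3D.Theorems

end
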